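import Summits.AtomisticToContinuum.HydrodynamicLimit.Theorems.OneFlightGossipEngineClampedCurrentsDockLogPartition
import HarnessLib

/-!
# Static telescoping, analysis half (stub `stub_staticTelescoping`, SC-a)

Crux `Summit.AtomisticToContinuum.HydrodynamicLimit.Theses.OneFlightGossipEngine.ClampedCurrentsDock`
(stmt-AtomisticToContinuum-14680), line `IdeatorTwoSketch`, registered stub SC-a
`stub_staticTelescoping : StaticTelescoping` (the def re-declared verbatim from the line skeleton; finding
STATIC-TELESCOPING of lead c2, `Cruxes/ClampedCurrentsDock/STATIC-TELESCOPING.md`).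

For a jointly smooth positive activity family `a : ℝ → 𝕋³ → ℝ` on `[0,T) × 𝕋³` with `Z_pos(a_s) > 0`, write
`D_N(r) = Z_pos(a_r)⁻¹ ∫ posWeight(a_r)(x) Σᵢ ∂_r a_r(xᵢ)/a_r(xᵢ) dx` for the canonical mean of `Σᵢ ∂_r log a_r(xᵢ)`
(`N + 1` spheres of diameter `hsDiameter σ N`). If `|D_N(r)| ≤ (N+1) M` on `[0,t]` and `D_N(r)/(N+1) → ℓ(r)` for
every `r ∈ [0,t]`, `ℓ` continuous on `[0,t]`, `0 < t < T`, then uniformly in `t′ ∈ [0,t]`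
`|log Z_pos(a_{t′}) − log Z_pos(a_0) − (N+1)∫₀^{t′} ℓ| ≤ (N+1) ε` for `N ≥ N₀(ε)`.

Proof: the landed log-partition increment (LPI, `ClampedCurrentsDockLogPartition.stub_logPartitionIncrement`)
at `(s₁, s₂) = (0, t′)` gives `log Z_pos(a_{t′}) − log Z_pos(a_0) = ∫₀^{t′} D_N`, so the difference is
`(N+1) ∫₀^{t′} (D_N/(N+1) − ℓ)`, bounded by `(N+1) ∫₀^{t} |D_N/(N+1) − ℓ|`, and the last integral tends to `0` by
dominated convergence on `[0,t]` (pointwise limit `0`, constant bound `|M| + sup_{[0,t]} |ℓ|`).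
-/

noncomputable section

namespace Summit.AtomisticToContinuum.HydrodynamicLimit.Theorems.ClampedCurrentsDockStaticTelescoping

open scoped BigOperators ENNReal Classical Interval
open MeasureTheory Filter Set Topology InformationTheory
open Literature.MathematicalPhysics.KineticTheory Literature.Analysis.FluidPDE Literature.Analysis.FunctionSpaces
open Summit.AtomisticToContinuum.HydrodynamicLimit.Theorems

/-! ## The statement (verbatim from the line skeleton) -/

/-- registered stub signature SC-a of line IdeatorTwoSketch, crux ClampedCurrentsDock — route-internal, not a cited fact -/
def StaticTelescoping : Prop :=
  ∀ (σ T : ℝ) (a : ℝ → T3 → ℝ), Torus.IsSmoothSpaceTimeOn (Ico 0 T) a → (∀ s ∈ Ico 0 T, ∀ x, 0 < a s x) →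
    (∀ (N : ℕ), ∀ s ∈ Ico 0 T, 0 < posPartition (a s) (hsDiameter σ N) (N + 1)) →
    ∀ t ∈ Ioo 0 T, ∀ (ℓ : ℝ → ℝ), ContinuousOn ℓ (Icc 0 t) → ∀ M : ℝ,
    (let D := fun (N : ℕ) (r : ℝ) => (posPartition (a r) (hsDiameter σ N) (N + 1))⁻¹ *
        ∫ x : Fin (N + 1) → T3, posWeight (a r) (hsDiameter σ N) (N + 1) x *
          ∑ i, Torus.timeDerivWithin (Ico 0 T) a r (x i) / a r (x i)
     (∀ (N : ℕ), ∀ r ∈ Icc 0 t, |D N r| ≤ ((N : ℝ) + 1) * M) →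
     (∀ r ∈ Icc 0 t, Tendsto (fun N : ℕ => D N r / ((N : ℝ) + 1)) atTop (𝓝 (ℓ r))) →
     ∀ ε : ℝ, 0 < ε → ∃ N₀ : ℕ, ∀ N : ℕ, N₀ ≤ N → ∀ t' ∈ Icc 0 t,
       |Real.log (posPartition (a t') (hsDiameter σ N) (N + 1)) - Real.log (posPartition (a 0) (hsDiameter σ N) (N + 1)) -
           ((N : ℝ) + 1) * ∫ r in (0 : ℝ)..t', ℓ r| ≤ ((N : ℝ) + 1) * ε)

/-! ## The real-analysis core -/

/-- **Dominated convergence, uniformly in the upper limit.** If `|D_N| ≤ (N+1) M` on `[0,t]`,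
`D_N(r)/(N+1) → ℓ(r)` pointwise on `[0,t]` with `ℓ` continuous, each `D_N` is interval-integrable on `[0,t]`,
and `L_N(t′) − L_N(0) = ∫₀^{t′} D_N` for `t′ ∈ [0,t]`, then
`|L_N(t′) − L_N(0) − (N+1)∫₀^{t′} ℓ| ≤ (N+1) ε` for all `t′ ∈ [0,t]` once `N ≥ N₀(ε)`. [folklore] -/
theorem telescoping_of_dominated {t M : ℝ} (ht0 : 0 < t) {D L : ℕ → ℝ → ℝ} {ℓ : ℝ → ℝ}
    (hℓ : ContinuousOn ℓ (Icc 0 t)) (hD : ∀ (N : ℕ), ∀ r ∈ Icc 0 t, |D N r| ≤ ((N : ℝ) + 1) * M)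
    (hlim : ∀ r ∈ Icc 0 t, Tendsto (fun N : ℕ => D N r / ((N : ℝ) + 1)) atTop (𝓝 (ℓ r)))
    (hint : ∀ N : ℕ, IntervalIntegrable (D N) volume 0 t)
    (heq : ∀ (N : ℕ), ∀ t' ∈ Icc 0 t, L N t' - L N 0 = ∫ r in (0 : ℝ)..t', D N r) :
    ∀ ε : ℝ, 0 < ε → ∃ N₀ : ℕ, ∀ N : ℕ, N₀ ≤ N → ∀ t' ∈ Icc 0 t,
      |L N t' - L N 0 - ((N : ℝ) + 1) * ∫ r in (0 : ℝ)..t', ℓ r| ≤ ((N : ℝ) + 1) * ε := by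
  intro ε hε
  obtain ⟨C, hC⟩ := isCompact_Icc.exists_bound_of_continuousOn hℓ
  have hℓint : ∀ t' ∈ Icc 0 t, IntervalIntegrable ℓ volume 0 t' := fun t' ht' =>
    (hℓ.mono (Icc_subset_Icc_right ht'.2)).intervalIntegrable_of_Icc ht'.1
  have hDint : ∀ (N : ℕ), ∀ t' ∈ Icc 0 t, IntervalIntegrable (D N) volume 0 t' := fun N t' ht' =>
    (hint N).mono_set (by
      rw [uIcc_of_le ht'.1, uIcc_of_le ht0.le]
      exact Icc_subset_Icc_right ht'.2)
  -- the normalised defect `g_N = D_N/(N+1) - ℓ`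
  set g : ℕ → ℝ → ℝ := fun N r => D N r / ((N : ℝ) + 1) - ℓ r with hg
  have hgint : ∀ (N : ℕ), ∀ t' ∈ Icc 0 t, IntervalIntegrable (g N) volume 0 t' := fun N t' ht' =>
    ((hDint N t' ht').div_const _).sub (hℓint t' ht')
  have htt : t ∈ Icc 0 t := ⟨ht0.le, le_rfl⟩
  have hmemI : ∀ r ∈ Ι (0 : ℝ) t, r ∈ Icc 0 t := fun r hr => by
    rw [uIoc_of_le ht0.le] at hr
    exact ⟨hr.1.le, hr.2⟩
  -- dominated convergence on `[0, t]`
  have hF : Tendsto (fun N : ℕ => ∫ r in (0 : ℝ)..t, |g N r|) atTop (𝓝 0) := by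
    have h := intervalIntegral.tendsto_integral_filter_of_dominated_convergence (μ := volume)
      (l := atTop) (F := fun (N : ℕ) r => |g N r|) (f := fun _ => (0 : ℝ)) (a := 0) (b := t)
      (fun _ => |M| + C) ?_ ?_ ?_ ?_
    · rwa [intervalIntegral.integral_zero] at h
    · exact Eventually.of_forall fun N => ((hgint N t htt).abs).def'.aestronglyMeasurable
    · refine Eventually.of_forall fun N => Eventually.of_forall fun r hr => ?_
      have hr' : r ∈ Icc 0 t := hmemI r hr
      have hN1 : (0 : ℝ) < (N : ℝ) + 1 := Nat.cast_add_one_pos N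
      rw [Real.norm_eq_abs, abs_abs]
      calc |g N r| ≤ |D N r / ((N : ℝ) + 1)| + |ℓ r| := abs_sub _ _
        _ ≤ |M| + C := by
          refine add_le_add ?_ (by simpa only [Real.norm_eq_abs] using hC r hr')
          rw [abs_div, abs_of_pos hN1, div_le_iff₀ hN1]
          calc |D N r| ≤ ((N : ℝ) + 1) * M := hD N r hr'
            _ ≤ |M| * ((N : ℝ) + 1) := by
              rw [mul_comm]
              exact mul_le_mul_of_nonneg_right (le_abs_self M) hN1.le
    · exact intervalIntegrable_const
    · refine Eventually.of_forall fun r hr => ?_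
      have h1 : Tendsto (fun N : ℕ => g N r) atTop (𝓝 (ℓ r - ℓ r)) := (hlim r (hmemI r hr)).sub_const (ℓ r)
      rw [sub_self] at h1
      simpa only [abs_zero] using h1.abs
  obtain ⟨N₀, hN₀⟩ := Metric.tendsto_atTop.1 hF ε hε
  refine ⟨N₀, fun N hN t' ht' => ?_⟩
  have hN1 : (0 : ℝ) < (N : ℝ) + 1 := Nat.cast_add_one_pos N
  have i1 : ∫ r in (0 : ℝ)..t', g N r = (∫ r in (0 : ℝ)..t', D N r / ((N : ℝ) + 1)) - ∫ r in (0 : ℝ)..t', ℓ r :=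
    intervalIntegral.integral_sub ((hDint N t' ht').div_const _) (hℓint t' ht')
  have key : L N t' - L N 0 - ((N : ℝ) + 1) * ∫ r in (0 : ℝ)..t', ℓ r =
      ((N : ℝ) + 1) * ∫ r in (0 : ℝ)..t', g N r := by
    rw [i1, intervalIntegral.integral_div, heq N t' ht', mul_sub, mul_div_cancel₀ _ hN1.ne']
  rw [key, abs_mul, abs_of_pos hN1]
  refine mul_le_mul_of_nonneg_left ?_ hN1.le
  have hFN := hN₀ N hN
  rw [Real.dist_eq, sub_zero,
    abs_of_nonneg (intervalIntegral.integral_nonneg ht0.le fun r _ => abs_nonneg _)] at hFN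
  calc |∫ r in (0 : ℝ)..t', g N r| ≤ ∫ r in (0 : ℝ)..t', |g N r| :=
        intervalIntegral.abs_integral_le_integral_abs ht'.1
    _ ≤ ∫ r in (0 : ℝ)..t, |g N r| :=
        intervalIntegral.integral_mono_interval le_rfl ht'.1 ht'.2
          (Eventually.of_forall fun r => abs_nonneg _) (hgint N t htt).abs
    _ ≤ ε := hFN.le

/-! ## The stub -/

/-- **STUB SC-a `stub_staticTelescoping`** of line `IdeatorTwoSketch` (crux `ClampedCurrentsDock`, stmt-14680):
the static clause of `OneWindowLedgerStatic` with `Cst = −ℓ`, from the landed log-partition increment and dominated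
convergence in `r ∈ [0,t]`, uniformly in the upper limit `t′`. [folklore] -/
theorem stub_staticTelescoping : StaticTelescoping := by
  intro σ T a hu ha0 hZ t ht ℓ hℓ M D hD hlim
  have hLPI := fun (N : ℕ) (t' : ℝ) (ht' : t' ∈ Icc 0 t) =>
    ClampedCurrentsDockLogPartition.stub_logPartitionIncrement (hsDiameter σ N) T (N + 1) a hu ha0
      (fun s hs => hZ N s hs) 0 t' le_rfl ht'.1 (ht'.2.trans_lt ht.2)
  exact telescoping_of_dominated ht.1 hℓ hD hlim (fun N => (hLPI N t ⟨ht.1.le, le_rfl⟩).2.1)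
    fun N t' ht' => (hLPI N t' ht').2.2

end Summit.AtomisticToContinuum.HydrodynamicLimit.Theorems.ClampedCurrentsDockStaticTelescoping
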